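import Literature.AlgebraicGeometry.HodgeTheory.QuarticQuinticFourfoldHodgeClassesAlgebraicProofs
import Literature.AlgebraicGeometry.Motives.ChowZeroSupportedOnHyperplaneSectionOfDegreeLE
import Literature.Barriers.HodgeConjecture.DecompositionOfTheDiagonalDegreeFourHolds
import HarnessLib

/-!
# The Hodge conjecture for quartic and quintic fourfolds (Conte–Murre 1978) — discharge of
# `hodgeTwoTwo_algebraic_quarticQuinticFourfold`

Family `hodge`, layer `Literature/AlgebraicGeometry/HodgeTheory`. THEOREMS ONLY (no definition, no named
fact).

The named fact `hodgeTwoTwo_algebraic_quarticQuinticFourfold` (`QuarticQuinticFourfoldHodgeClassesAlgebraic`: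
on a smooth quartic or quintic fourfold `X ⊂ ℙ⁵_ℂ` every rational `(2,2)`-class in `H⁴(X(ℂ); ℂ)` is
algebraic — A. Conte, J. P. Murre, Math. Ann. 238 (1978); J. P. Murre, Torino lectures, LNM 1594, Ch. V
§5.3.1 "the Hodge `(2,2)`-conjecture is true for smooth `V(3)`, `V(4)` and `V(5)` in `ℙ₅`") was reduced
in the tree (`QuarticQuinticFourfoldHodgeClassesAlgebraicProofs`,
`hodgeTwoTwo_algebraic_quarticQuinticFourfold_of_blochSrinivas_of_forall_point`) to Bloch–Srinivas'
theorem in degree four (Voisin II Prop. 10.26: rational `(2,2)`-classes on a smooth projective complex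
variety with `CH₀` supported in dimension `≤ 3` are algebraic — the barrier-layer fact
`BlochSrinivas1983_hodgeConjectureDegreeFour_of_chowZeroSupported`, since DISCHARGED in
`Barriers/HodgeConjecture/DecompositionOfTheDiagonalDegreeFourHolds` through the Hodge-compatible Gysin
formalism of the complex orientations) and the point-wise `CH₀`-support of the hypersurface on a
hyperplane section, which for a smooth hypersurface of degree `2 ≤ e ≤ n + 1` in `ℙⁿ⁺¹` is Roitman's
theorem by "strong lines" (a line of full contact at the point; the tree's
`Motives.Hypersurface.exists_forall_isRationallyEquivalent_primeCycle_of_degree_le`,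
`ChowZeroSupportedOnHyperplaneSectionOfDegreeLE`; Voisin II, remark following Prop. 10.26). Both inputs
being Literature theorems, the fact is a theorem of the Literature layer:

* `exists_forall_isRationallyEquivalent_primeCycle_of_isSmoothHypersurface_of_two_le` — Roitman's
  `CH₀`-support transported to the carrier `Motives.IsSmoothHypersurface n e X` (`2 ≤ e ≤ n + 1`);
* `hasChowZeroSupportedInDimLE_three_of_isSmoothHypersurface_four` — every smooth hypersurface fourfold
  of degree `1 ≤ d ≤ 5` has `CH₀` supported in dimension `≤ 3`;
* `hodgeTwoTwo_algebraic_quarticQuinticFourfold_holds` — **the discharge** (exact `<FQN>_holds`).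

Provenance: Literature home of the Summits-side
`Theorems/LimitExtensionHypersurfaceHodgeFourLowDegreeStrongLines` /
`Theorems/LimitExtensionHypersurfaceHodgeFourQuarticQuinticHolds` (route `LimitExtension`, item
`HypersurfaceHodgeFourLowDegree`, stmt-HodgeConjecture-3003), which `Literature/` may not import. Lane
`lit-hodgefound`, seat p20.

## References

* [ConteMurre1978] A. Conte, J. P. Murre, The Hodge conjecture for fourfolds admitting a covering by
  rational curves, Math. Ann. 238 (1978) 79–88.
* [MurreTorino1994] J. P. Murre, Algebraic cycles and algebraic aspects of cohomology and K-theory,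
  LNM 1594 (1994), Ch. V §5.3.1.
* [VoisinHodgeII2003] C. Voisin, Hodge Theory and Complex Algebraic Geometry II, Prop. 10.26 and the
  remark following it (§10.2.3).
* [HirschowitzIyer2010] A. Hirschowitz, J. Iyer, Hilbert schemes of fat r-planes and the triviality of
  Chow groups of complete intersections, §1.3 and proof of Prop. 6.2 (i).
* [Roitman1980] A. A. Roitman, Rational equivalence of zero-cycles, Math. USSR Sb. (1980).
* [BlochSrinivas1983] S. Bloch, V. Srinivas, Remarks on correspondences and algebraic cycles, Amer. J.
  Math. 105 (1983), Thm. 1 (3).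
-/

noncomputable section

open CategoryTheory AlgebraicGeometry MonoidalCategory Order
open Literature.AlgebraicTopology.SingularHomology
open Literature.AlgebraicGeometry.HodgeTheory Literature.AlgebraicGeometry.Motives
  Literature.Barriers.HodgeConjecture Literature.AlgebraicGeometry

namespace Literature.AlgebraicGeometry.HodgeTheory

/-- **`CH₀` of a smooth complex hypersurface of degree `2 ≤ e ≤ n + 1` is supported on a hyperplane
section, point by point** (Roitman's strong lines,
`Motives.Hypersurface.exists_forall_isRationallyEquivalent_primeCycle_of_degree_le`, transported to
`Motives.IsSmoothHypersurface n e X`: the cutting-out closed immersion `X ↪ ℙⁿ⁺¹_ℂ` with image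
`V₊(F)`, `F` irreducible hence prime). [cite: HirschowitzIyer2010, §1.3 and proof of Prop. 6.2 (i)]
[cite: Roitman1980] [cite: VoisinHodgeII2003, remark following Prop. 10.26 (§10.2.3)] -/
theorem exists_forall_isRationallyEquivalent_primeCycle_of_isSmoothHypersurface_of_two_le
    {n e : ℕ} {X : SchemeOver ℂ} (hX : IsSmoothHypersurface n e X) (he2 : 2 ≤ e) (hen : e ≤ n + 1) :
    ∃ W : Set ↥X.left, IsClosed W ∧ W ≠ Set.univ ∧
      ∀ x : ↥X.left, height x = 0 →
        ∃ c' ∈ Motives.cyclesOfDim X.left 0, (∀ z, c' z ≠ 0 → z ∈ W) ∧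
          Motives.IsRationallyEquivalent (Motives.primeCycle x) c' 0 := by
  obtain ⟨hsp, F, hF, hirr, -, i, hi, hV⟩ := hX
  haveI := hi
  haveI := hsp.smoothOfRelativeDimension
  haveI : Smooth X.hom := SmoothOfRelativeDimension.smooth n _
  haveI : LocallyOfFiniteType X.hom := inferInstance
  haveI : IsIntegral X.left := Motives.IsSmoothProjective.isIntegral_holds hsp
  exact Hypersurface.exists_forall_isRationallyEquivalent_primeCycle_of_degree_le (d := n) i
    ((MvPolynomial.mem_homogeneousSubmodule e F).2 hF)
    (UniqueFactorizationMonoid.irreducible_iff_prime.mp hirr) hV he2 hen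

/-- **Every smooth hypersurface fourfold of degree `1 ≤ d ≤ 5` satisfies the hypothesis of Voisin II
Prop. 10.26** (`HasChowZeroSupportedInDimLE X 3`): `d ≤ 4` by lines through every point
(`hasChowZeroSupportedInDimLE_of_isSmoothHypersurface`), `2 ≤ d ≤ 5` by Roitman's strong lines.
[cite: VoisinHodgeII2003, Prop. 10.26 and the remark following it (§10.2.3)]
[cite: HirschowitzIyer2010, §1.3 and proof of Prop. 6.2 (i)] -/
theorem hasChowZeroSupportedInDimLE_three_of_isSmoothHypersurface_four
    ⦃d : ℕ⦄ ⦃X : SchemeOver ℂ⦄ (hd0 : 0 < d) (hd : d ≤ 5) (hX : IsSmoothHypersurface 4 d X) :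
    HasChowZeroSupportedInDimLE X 3 := by
  rcases Nat.lt_or_ge d 2 with hlt | h2
  · exact hasChowZeroSupportedInDimLE_of_isSmoothHypersurface hX hd0 (by omega)
  · obtain ⟨W, hW, hWu, hpt⟩ :=
      exists_forall_isRationallyEquivalent_primeCycle_of_isSmoothHypersurface_of_two_le hX h2 (by omega)
    exact ⟨W, chowZeroSupportedInDimLE_of_forall_point hX.1 (by norm_num) hW hWu hpt⟩

/-- **The Hodge conjecture for quartic and quintic fourfolds (Conte–Murre 1978), the tree's named fact
`hodgeTwoTwo_algebraic_quarticQuinticFourfold`, PROVED**: every rational `(2,2)`-class on a smooth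
quartic or quintic fourfold `X ⊂ ℙ⁵_ℂ` is algebraic — Bloch–Srinivas / Voisin II Prop. 10.26 in degree
four (`BlochSrinivas1983_hodgeConjectureDegreeFour_of_chowZeroSupported_holds`) applied to the
`CH₀`-support of the fourfold on a hyperplane section (Roitman's strong lines, `5 ≤ 4 + 1`), via the
tree's reduction `hodgeTwoTwo_algebraic_quarticQuinticFourfold_of_blochSrinivas_of_forall_point`.
[cite: MurreTorino1994, Ch. V §5.3.1, Theorem ([CM 1]) and Applications] [cite: ConteMurre1978]
[cite: VoisinHodgeII2003, Prop. 10.26 and the remark following it (§10.2.3)] -/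
theorem hodgeTwoTwo_algebraic_quarticQuinticFourfold_holds : hodgeTwoTwo_algebraic_quarticQuinticFourfold :=
  hodgeTwoTwo_algebraic_quarticQuinticFourfold_of_blochSrinivas_of_forall_point
    BlochSrinivas1983_hodgeConjectureDegreeFour_of_chowZeroSupported_holds fun _ hX ↦
    exists_forall_isRationallyEquivalent_primeCycle_of_isSmoothHypersurface_of_two_le hX
      (by norm_num) (by norm_num)

end Literature.AlgebraicGeometry.HodgeTheory

end
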